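import Literature.MathematicalPhysics.QuantumFieldTheory.Balaban1983to89.B9Thm31SiteGsqCutoffMixedReg335Y
import Literature.MathematicalPhysics.QuantumFieldTheory.Balaban1983to89.B9Thm37CubeCoverCommutatorSizes

/-!
# `Balaban1983to89.B9Thm31SiteGsqCutoffFactorsReg335Y` — T. Bałaban, *Propagators for lattice gauge theories in a background field*, Commun. Math. Phys.
# **99** (1985) 389–434 [Balaban1985BackgroundPropagators] (3.88)–(3.89) p. 409 ∕ Cor 3.6 p. 408 ∕ (3.46) p. 398, with [4] = [Balaban1984PropagatorsII] (2.40)–(2.44)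
# p. 230, p. 247: ★★★ **THE `K(h_□)`-FACTOR `K(h)(U) G′_□(U) M_h ∇*_{U,μ}` OF THE WALK IN `L²`, UNIFORMLY IN □** — the 𝔸-level shape of dag-n06-k's `FactorsL2Mixed37.facDs`
# at def-Y's genuine local cube inverses and lit-balaban's genuine commutator `KhY` (file 23 of the site-sector set of width seat `pub-ymgap-dag-n06-w1`; file 22 =
# `B9Thm31SiteGsqCutoffMixedReg335Y` is the sandwiched mixed member)

statement-level skeleton of published theorems with citation tags; proofs where landed; nothing here is a claim about the Yang–Mills mass gap

THE PRINT (verbatim).  p. 409, (3.88)–(3.89): *«Δ′_aG′₀ = I − Σ_□K(h_□)G′_□h_□ = I − R′ … Using the inequalities (3.42) for G′_□, we get the bound |(K(h_□)G′_□h_□λ)(x)| ≤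
O(M⁻¹)e^{−δ₀(Lʲη)⁻¹|y−y′|}|λ| (3.89)»*; [4] p. 247: *«|∂h_□| ≤ O(1)(MLʲη)⁻¹, |Δh_□| ≤ O(1)(MLʲη)⁻²»*; p. 408, Cor 3.6 («constants independent of □»).

WHY THIS FILE (cell `pub-ymgap`, node N06 [B9], width seat `pub-ymgap-dag-n06-w1`, gen 3).  Row 18's walk displays, next to the mixed `L²` member of the cube operators
(`L2MixedLegs37`, file 22), the `L²` size of the terms of `R′∇*_μ` — `(P_□∇_U + C_□)G′_□(U)h_□∇*_{U,μ}` with the bound `1_{S′_□}(y)·θ_M·(Lʲη)⁻¹·e^{−δ₀d(y,y′)}`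
(`FactorsL2Mixed37.facDs`, dag-n06-k) — where `P_□∇_U + C_□ = K(h_□)` is lit-balaban's genuine commutator `KhY i par h U = M_hΔ′_a(U) − Δ′_a(U)M_h` of (3.88)
(`B9Thm37CubeCoverCommutators`, with its two printed lines `cutCommY_lapSL_apply_print` and the averaging kernel).  THIS FILE bounds that factor at the 𝔸 level, □-free:
the `HS` size of `(K(h)Λ)(z)` by first differences of `h` against `∇Λ, ∇*Λ` at `z`, second differences against `Λ z`, and the block oscillation of `h` against the
`m_z`-weighted block of `Λ` (§K2), then summed over a block-saturated `A` with `Λ = Φ := G′_□(U)M_h∇*_μλ` through file 22's two □-uniform inputs (`Φ` and `∇Φ` on `A`):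
`Σ_{z∈A}HS((K(h)Φ)(z)) ≤ [16(d+1)(d+2)κ²(10 + 160κ²L^{2j_B}) + (8(d+1)²κ₂² + 4κ_b²L^{−4j′_A})(16 + 256κ²L^{2j_B})L^{2j_A}]∕W²·‖λ‖²₁` — with [4]'s sizes
`κ = O((MLʲ)⁻¹)`, `κ₂ = O((MLʲ)⁻²)`, `κ_b = O(M⁻¹)` (lit-balaban `abs_hTY_shiftY_sub_le`, `abs_hT_second_diff_le`, `abs_hTY_sub_le_of_avgCoeffY_ne_zero`) and
`j′_A ≈ j_A ≈ j` this is print's `θ_M²(Lʲη)⁻²e^{−2δ₀d}`, `θ_M = O(M⁻¹)`.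

WHAT IS PROVED (sorry-free; 0 `def`).  `G ≤ U(N)`; §K3 on the class `(bg9K (M_N ℂ) G i).Reg335 c α₀`, `N ≥ 1`, `0 ≤ c·M·α₀`, `c·M·α₀·(d+1) ≤ 1∕16`.
* §K1 `HS` bookkeeping: `hs_sum_le_card_mul` (`HS(Σ_kX_k) ≤ |s|ΣHS(X_k)`), `hs_sum_smul_le_of_abs_le` (weighted Cauchy–Schwarz `HS(Σ_wα_w•Y_w) ≤ (Σβ)(Σβ_wHS(Y_w))`, `|α| ≤ β`).
* §K2 ★★ `hs_KhY_apply_le` (regime-free, every `G`-valued `U`): `HS((K(h)Λ)(z)) ≤ 8(d+1)κ²Σ_μ[HS(∇_μΛ z) + HS(∇*_μΛ z)] + 4((d+1)κ₂)²HS(Λ z) +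
  2κ_b²·m_z·Σ_w avgCoeffY(z,w)HS(Λ w)`.
* §K3 `hs_cdsS_le_hs_cdS_symm` (`HS(∇*_μΦ(z)) ≤ HS(∇_μΦ(z−e_μ))`), ★★★ `hs_restrict_KhY_GsqY_cutMulY_cdsS_le` — the factor above (weight `= 1` on `B ⊇ supp λ ∪ (supp λ + e_μ)`,
  `≥ W` on `A` and on `A − e_ν`, `A` block-saturated with levels in `[j′_A, j_A]`, levels `≤ j_B` on `B`).
MODEL ∕ SCOPE.  As files 19–22; `K(h) = KhY` and `M_h = cutMulY` BY NAME (lit-balaban), `avgCoeffY ∕ avgTrY` (def-Y).  NOT HERE: the instantiation `h = hTY c`,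
`D = cubeDomY x c`, `A, B` = blocks and the coordinate∕block-`L²` reading (dag-n06-d FILE C ∕ dag-n06-k); the second-order factors (`FactorsL2Second37`); the sup-norm (3.89).
NON-VACUITY (A6): `U ≡ 1 ∈ Reg335`, canonical weight, `h ≡ 1` (`κ = κ₂ = κ_b = 0`).  HONEST SCOPE: bookkeeping over landed estimates; NOT a node discharge, NOT summit
progress; count-neutral; nothing continuum ∕ OS ∕ mass gap ∕ Clay.  NEW file importing file 22 and `B9Thm37CubeCoverCommutatorSizes` only.  Net new unproved facts: 0.
-/

noncomputable section

namespace Literature.MathematicalPhysics.QuantumFieldTheory.Balaban1983to89.B9Thm31SiteGsqCutoffFactorsReg335Y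

open Literature.MathematicalPhysics.QuantumFieldTheory.Balaban1983to89
open Node00 B6KLevelCensusIndexV1 B6Geom246MultiLevelBox B6MultiLevelBoxOperator B6MultiLevelTorusOperator B6GlobalChartV1 B9BackgroundsKLevelV1
  B9Eq39Adjoint B9Thm311ReadingCoords B9Thm311DeltaPrimePos B9Ineq369CurvatureSmallAtLettersY B9Thm31SiteCoerciveGaugeBlockY B9Thm31SiteCoerciveReg335Y
  B9Thm31SiteGpBoundsReg335Y B9Thm31SitePolarisedFormY B9Thm31SiteConjugatedFormY B9Thm31SiteGpDecayReg335Y B9Thm31SiteAgmonWeightY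
  B9Thm31SiteGpGradDecayReg335Y B9Thm31SiteGpDivDecayReg335Y B9Thm31SiteGradGpDivDecayReg335Y Node00.OpsYLocalInverse B9Thm311LocalInversePosY
  B9Thm31SiteGsqBoundsReg335Y B9Thm31SiteGsqDecayReg335Y B9Thm31SiteGsqGradDecayReg335Y B9Thm31SiteGsqCutoffMixedReg335Y
open Literature.MathematicalPhysics.QuantumFieldTheory.Balaban1983to89.B9Ineq349SiteAdjoint (trIP_comm trIP_cdS_left)
open Literature.MathematicalPhysics.QuantumFieldTheory.Balaban1983to89.B9Thm311FlippedBondLetters (hs_real_smul)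
open Literature.MathematicalPhysics.QuantumFieldTheory.Balaban1983to89.B9Thm37CubeCoverCommutators (cutMulY cutMulY_apply KhY KhY_eq_add cutCommY cutCommY_lapSL_apply_print)
open Literature.MathematicalPhysics.QuantumFieldTheory.Balaban1983to89.B9Thm37CubeCoverCommutatorSizes (avgCoeffY_nonneg)
open Literature.MathematicalPhysics.QuantumFieldTheory.Balaban1983to89.B9Thm311DeltaPrimeSymm (avgCoeffY_eq_ite avgCoeffY_symm)
open scoped Matrix Matrix.Norms.L2Operator

variable {d ℓ : ℕ} {hd : 1 ≤ d + 1} {hL : Odd (ℓ + 1) ∧ 1 < ℓ + 1} {b₀ b₁ : ℝ}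
variable (i : KIdx d ℓ hd hL b₀ b₁) {N : ℕ} {G : Subgroup (Matrix (Fin N) (Fin N) ℂ)ˣ}

section Factors

/-! ## §K1 `HS` bookkeeping: Cauchy–Schwarz for finite and weighted sums of matrices -/

/-- `HS(Σ_{k∈s} X_k) ≤ |s|·Σ_{k∈s} HS(X_k)`. [cite: Balaban1985BackgroundPropagators, (3.88) p.409, bookkeeping] -/
theorem hs_sum_le_card_mul {ι : Type} (s : Finset ι) (X : ι → Matrix (Fin N) (Fin N) ℂ) :
    ∑ a, ∑ b, ‖(∑ k ∈ s, X k) a b‖ ^ 2 ≤ (s.card : ℝ) * ∑ k ∈ s, ∑ a, ∑ b, ‖X k a b‖ ^ 2 := by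
  calc ∑ a, ∑ b, ‖(∑ k ∈ s, X k) a b‖ ^ 2 ≤ ∑ a, ∑ b, (∑ k ∈ s, ‖X k a b‖) ^ 2 := by
        refine Finset.sum_le_sum fun a _ => Finset.sum_le_sum fun b _ => ?_
        rw [Matrix.sum_apply]
        exact pow_le_pow_left₀ (norm_nonneg _) (norm_sum_le _ _) 2
    _ ≤ ∑ a, ∑ b, ((s.card : ℝ) * ∑ k ∈ s, ‖X k a b‖ ^ 2) :=
        Finset.sum_le_sum fun a _ => Finset.sum_le_sum fun b _ => sq_sum_le_card_mul_sum_sq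
    _ = (s.card : ℝ) * ∑ a, ∑ b, ∑ k ∈ s, ‖X k a b‖ ^ 2 := by simp only [Finset.mul_sum]
    _ = (s.card : ℝ) * ∑ k ∈ s, ∑ a, ∑ b, ‖X k a b‖ ^ 2 := by
        congr 1
        rw [Finset.sum_congr rfl fun a _ => Finset.sum_comm, Finset.sum_comm]

/-- the WEIGHTED Cauchy–Schwarz with SIGNED weights: for real `α_w` with `|α_w| ≤ β_w`, `HS(Σ_w α_w•Y_w) ≤ (Σ_w β_w)·Σ_w β_w·HS(Y_w)` (the non-negative-weight case is
dag-n06-i's `B9Eq3132TentOverlap.hs_sum_smul_le`; here the averaging commutator's weights `avgCoeffY(z,w)·(h z − h w)` change sign).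
[cite: Balaban1985BackgroundPropagators, (3.88) p.409 (second line), bookkeeping] -/
theorem hs_sum_smul_le_of_abs_le {ι : Type} [Fintype ι] (α β : ι → ℝ) (hαβ : ∀ w, |α w| ≤ β w) (Y : ι → Matrix (Fin N) (Fin N) ℂ) :
    ∑ a, ∑ b, ‖(∑ w, ((α w : ℝ) : ℂ) • Y w) a b‖ ^ 2 ≤ (∑ w, β w) * ∑ w, β w * ∑ a, ∑ b, ‖Y w a b‖ ^ 2 := by
  have hβ0 : ∀ w, 0 ≤ β w := fun w => le_trans (abs_nonneg _) (hαβ w)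
  have hentry : ∀ a b, ‖(∑ w, ((α w : ℝ) : ℂ) • Y w) a b‖ ^ 2 ≤ (∑ w, β w) * ∑ w, β w * ‖Y w a b‖ ^ 2 := by
    intro a b
    rw [Matrix.sum_apply]
    have h1 : ‖∑ w, (((α w : ℝ) : ℂ) • Y w) a b‖ ≤ ∑ w, Real.sqrt (β w) * (Real.sqrt (β w) * ‖Y w a b‖) := by
      refine (norm_sum_le _ _).trans (Finset.sum_le_sum fun w _ => ?_)
      rw [Matrix.smul_apply, norm_smul, Complex.norm_real, Real.norm_eq_abs, ← mul_assoc, Real.mul_self_sqrt (hβ0 w)]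
      exact mul_le_mul_of_nonneg_right (hαβ w) (norm_nonneg _)
    have h2 := Finset.sum_mul_sq_le_sq_mul_sq Finset.univ (fun w => Real.sqrt (β w)) (fun w => Real.sqrt (β w) * ‖Y w a b‖)
    have h3 : ∑ w, Real.sqrt (β w) ^ 2 = ∑ w, β w := Finset.sum_congr rfl fun w _ => Real.sq_sqrt (hβ0 w)
    have h4 : ∑ w, (Real.sqrt (β w) * ‖Y w a b‖) ^ 2 = ∑ w, β w * ‖Y w a b‖ ^ 2 :=
      Finset.sum_congr rfl fun w _ => by rw [mul_pow, Real.sq_sqrt (hβ0 w)]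
    rw [h3, h4] at h2
    have h0 : 0 ≤ ∑ w, Real.sqrt (β w) * (Real.sqrt (β w) * ‖Y w a b‖) :=
      Finset.sum_nonneg fun w _ => mul_nonneg (Real.sqrt_nonneg _) (mul_nonneg (Real.sqrt_nonneg _) (norm_nonneg _))
    exact (pow_le_pow_left₀ (norm_nonneg _) h1 2).trans h2
  calc ∑ a, ∑ b, ‖(∑ w, ((α w : ℝ) : ℂ) • Y w) a b‖ ^ 2 ≤ ∑ a, ∑ b, ((∑ w, β w) * ∑ w, β w * ‖Y w a b‖ ^ 2) :=
        Finset.sum_le_sum fun a _ => Finset.sum_le_sum fun b _ => hentry a b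
    _ = (∑ w, β w) * ∑ a, ∑ b, ∑ w, β w * ‖Y w a b‖ ^ 2 := by simp only [← Finset.mul_sum]
    _ = (∑ w, β w) * ∑ w, β w * ∑ a, ∑ b, ‖Y w a b‖ ^ 2 := by
        congr 1
        calc ∑ a, ∑ b, ∑ w, β w * ‖Y w a b‖ ^ 2 = ∑ w, ∑ a, ∑ b, β w * ‖Y w a b‖ ^ 2 := by
              rw [Finset.sum_congr rfl fun a _ => Finset.sum_comm, Finset.sum_comm]
          _ = ∑ w, β w * ∑ a, ∑ b, ‖Y w a b‖ ^ 2 := Finset.sum_congr rfl fun w _ => by simp only [Finset.mul_sum]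

/-! ## §K2 The `HS` size of print's `K(h)(U)Λ` at a site: first differences of `h` against `∇Λ`, `∇*Λ`, second differences against `Λ`, block oscillation against the block of `Λ` -/

/-- ★ **THE `HS` SIZE OF `(K(h)(U)Λ)(z)`** at a `G`-valued `U`, `G ≤ U(N)`: if `|h(z+e_μ) − h z| ≤ κ` (all bonds), `|h(z+e_μ) + h(z−e_μ) − 2h z| ≤ κ₂` (all axes) and
`|h z − h w| ≤ κ_b` on every block of `𝔅`, then
`HS((K(h)Λ)(z)) ≤ 8(d+1)κ²·Σ_μ[HS((∇_μΛ)(z)) + HS((∇*_μΛ)(z))] + 4((d+1)κ₂)²·HS(Λ z) + 2κ_b²·m_z·Σ_w avgCoeffY(z,w)·HS(Λ w)` (`m_z = (L^{lev z})⁻²`; print's (3.88) first line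
in the shape `Σ_b ∂h·D_Uλ + Δh·λ`, second line the averaging commutator). [cite: Balaban1985BackgroundPropagators, (3.88)–(3.89) p.409; Balaban1984PropagatorsII, (2.40)–(2.44) p.230, p.247] -/
theorem hs_KhY_apply_le (hG : G ≤ B7Prop2Explicit.unitaryUnits (Matrix (Fin N) (Fin N) ℂ)) {U : CfgY (Matrix (Fin N) (Fin N) ℂ) i}
    (hU : ∀ μ x, U μ x ∈ G) {h : SiteY i → ℝ} {κ κ₂ κb : ℝ} (hhκ : ∀ μ z, |h (shiftY i μ z) - h z| ≤ κ)
    (hhκ₂ : ∀ μ z, |h (shiftY i μ z) + h ((shiftY i μ).symm z) - 2 * h z| ≤ κ₂)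
    (hhb : ∀ z w : SiteY i, blkOf i.D.toDomains w = blkOf i.D.toDomains z → |h z - h w| ≤ κb)
    (Λ : SiteY i → Matrix (Fin N) (Fin N) ℂ) (z : SiteY i) :
    ∑ a, ∑ b, ‖KhY i (parSymY i) h U Λ z a b‖ ^ 2
      ≤ 8 * ((d : ℝ) + 1) * κ ^ 2 * ∑ μ : Fin (d + 1), (∑ a, ∑ b, ‖cdS i U μ Λ z a b‖ ^ 2 + ∑ a, ∑ b, ‖cdsS i U μ Λ z a b‖ ^ 2)
        + 4 * (((d : ℝ) + 1) * κ₂) ^ 2 * ∑ a, ∑ b, ‖Λ z a b‖ ^ 2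
        + 2 * κb ^ 2 * (((((ℓ + 1) ^ (blkOf i.D.toDomains z).1.1 : ℕ) : ℝ)) ^ 2)⁻¹ * ∑ w, avgCoeffY i z w * ∑ a, ∑ b, ‖Λ w a b‖ ^ 2 := by
  have hκ0 : 0 ≤ κ := le_trans (abs_nonneg _) (hhκ (Classical.arbitrary _) z)
  -- the two lines of (3.88)
  rw [KhY_eq_add, LinearMap.add_apply, Pi.add_apply, cutCommY_lapSL_apply_print]
  set lineΔ := (∑ μ : Fin (d + 1), ((((h (shiftY i μ z) - h z : ℝ)) : ℂ) • cdS i U μ Λ z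
      + (((h ((shiftY i μ).symm z) - h z : ℝ)) : ℂ) • cdsS i U μ Λ z)) with hlineΔ
  set cst := ((((∑ μ : Fin (d + 1), (h (shiftY i μ z) + h ((shiftY i μ).symm z) - 2 * h z)) : ℝ) : ℂ)) with hcst
  set lineA := kernelTrOpY (fun z w => avgCoeffY i z w * (h z - h w)) (avgTrY i (parSymY i) U) Λ z with hlineA
  -- (1) the first-difference line
  have h1 : ∑ a, ∑ b, ‖lineΔ a b‖ ^ 2
      ≤ 2 * ((d : ℝ) + 1) * κ ^ 2 * ∑ μ : Fin (d + 1), (∑ a, ∑ b, ‖cdS i U μ Λ z a b‖ ^ 2 + ∑ a, ∑ b, ‖cdsS i U μ Λ z a b‖ ^ 2) := by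
    have hcs := hs_sum_le_card_mul (N := N) Finset.univ (fun μ : Fin (d + 1) => (((h (shiftY i μ z) - h z : ℝ)) : ℂ) • cdS i U μ Λ z
      + (((h ((shiftY i μ).symm z) - h z : ℝ)) : ℂ) • cdsS i U μ Λ z)
    rw [Finset.card_univ, Fintype.card_fin] at hcs
    refine hcs.trans ?_
    have hterm : ∀ μ : Fin (d + 1), ∑ a, ∑ b, ‖((((h (shiftY i μ z) - h z : ℝ)) : ℂ) • cdS i U μ Λ z
        + (((h ((shiftY i μ).symm z) - h z : ℝ)) : ℂ) • cdsS i U μ Λ z) a b‖ ^ 2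
        ≤ 2 * κ ^ 2 * (∑ a, ∑ b, ‖cdS i U μ Λ z a b‖ ^ 2 + ∑ a, ∑ b, ‖cdsS i U μ Λ z a b‖ ^ 2) := by
      intro μ
      have ha := hs_add_le ((((h (shiftY i μ z) - h z : ℝ)) : ℂ) • cdS i U μ Λ z) ((((h ((shiftY i μ).symm z) - h z : ℝ)) : ℂ) • cdsS i U μ Λ z)
      rw [hs_real_smul, hs_real_smul] at ha
      have hd1 : (h (shiftY i μ z) - h z) ^ 2 ≤ κ ^ 2 := by rw [← sq_abs]; exact pow_le_pow_left₀ (abs_nonneg _) (hhκ μ z) 2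
      have hd2 : (h ((shiftY i μ).symm z) - h z) ^ 2 ≤ κ ^ 2 := by
        have h0 := hhκ μ ((shiftY i μ).symm z)
        rw [Equiv.apply_symm_apply, abs_sub_comm] at h0
        rw [← sq_abs]; exact pow_le_pow_left₀ (abs_nonneg _) h0 2
      nlinarith [mul_le_mul_of_nonneg_right hd1 (hs_nonneg (cdS i U μ Λ z)), mul_le_mul_of_nonneg_right hd2 (hs_nonneg (cdsS i U μ Λ z))]
    calc ((d + 1 : ℕ) : ℝ) * ∑ μ : Fin (d + 1), ∑ a, ∑ b, ‖((((h (shiftY i μ z) - h z : ℝ)) : ℂ) • cdS i U μ Λ z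
          + (((h ((shiftY i μ).symm z) - h z : ℝ)) : ℂ) • cdsS i U μ Λ z) a b‖ ^ 2
        ≤ ((d + 1 : ℕ) : ℝ) * ∑ μ : Fin (d + 1), 2 * κ ^ 2 * (∑ a, ∑ b, ‖cdS i U μ Λ z a b‖ ^ 2 + ∑ a, ∑ b, ‖cdsS i U μ Λ z a b‖ ^ 2) :=
          mul_le_mul_of_nonneg_left (Finset.sum_le_sum fun μ _ => hterm μ) (Nat.cast_nonneg _)
      _ = _ := by rw [← Finset.mul_sum]; push_cast; ring
  -- (2) the second-difference term
  have h2 : ∑ a, ∑ b, ‖(cst • Λ z) a b‖ ^ 2 ≤ (((d : ℝ) + 1) * κ₂) ^ 2 * ∑ a, ∑ b, ‖Λ z a b‖ ^ 2 := by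
    rw [hcst, hs_real_smul]
    refine mul_le_mul_of_nonneg_right ?_ (hs_nonneg _)
    have hb : |∑ μ : Fin (d + 1), (h (shiftY i μ z) + h ((shiftY i μ).symm z) - 2 * h z)| ≤ ((d : ℝ) + 1) * κ₂ := by
      refine (Finset.abs_sum_le_sum_abs _ _).trans ?_
      calc ∑ μ : Fin (d + 1), |h (shiftY i μ z) + h ((shiftY i μ).symm z) - 2 * h z| ≤ ∑ _μ : Fin (d + 1), κ₂ :=
            Finset.sum_le_sum fun μ _ => hhκ₂ μ z
        _ = ((d : ℝ) + 1) * κ₂ := by rw [Finset.sum_const, Finset.card_univ, Fintype.card_fin, nsmul_eq_mul]; push_cast; ring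
    rw [← sq_abs]
    exact pow_le_pow_left₀ (abs_nonneg _) hb 2
  -- (3) the averaging line
  have h3 : ∑ a, ∑ b, ‖lineA a b‖ ^ 2
      ≤ κb ^ 2 * (((((ℓ + 1) ^ (blkOf i.D.toDomains z).1.1 : ℕ) : ℝ)) ^ 2)⁻¹ * ∑ w, avgCoeffY i z w * ∑ a, ∑ b, ‖Λ w a b‖ ^ 2 := by
    rw [hlineA, kernelTrOpY_apply]
    have hcs := hs_sum_smul_le_of_abs_le (N := N) (fun w => avgCoeffY i z w * (h z - h w)) (fun w => κb * avgCoeffY i z w) (fun w => ?_)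
      (fun w => R (avgTrY i (parSymY i) U z w) (Λ w))
    · refine hcs.trans ?_
      have hmem : ∀ w, avgTrY i (parSymY i) U z w ∈ G := fun w =>
        G.mul_mem (parSymY_mem i hU _ _) (parSymY_mem i hU _ _)
      have hR : ∀ w, ∑ a, ∑ b, ‖R (avgTrY i (parSymY i) U z w) (Λ w) a b‖ ^ 2 ≤ ∑ a, ∑ b, ‖Λ w a b‖ ^ 2 := fun w =>
        hs_R_le (contractive_of_mem_unitary (V := avgTrY i (parSymY i) U z w) (hG (hmem w))) (Λ w)
      have hsum : ∑ w, κb * avgCoeffY i z w ≤ κb * (((((ℓ + 1) ^ (blkOf i.D.toDomains z).1.1 : ℕ) : ℝ)) ^ 2)⁻¹ := by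
        rw [← Finset.mul_sum]
        exact mul_le_mul_of_nonneg_left (sum_avgCoeffY_le i z) (le_trans (abs_nonneg _) (hhb z z rfl))
      have hκb : 0 ≤ κb := le_trans (abs_nonneg _) (hhb z z rfl)
      have hS0 : 0 ≤ ∑ w, κb * avgCoeffY i z w * ∑ a, ∑ b, ‖Λ w a b‖ ^ 2 :=
        Finset.sum_nonneg fun w _ => mul_nonneg (mul_nonneg hκb (avgCoeffY_nonneg i z w)) (hs_nonneg _)
      calc (∑ w, κb * avgCoeffY i z w) * ∑ w, κb * avgCoeffY i z w * ∑ a, ∑ b, ‖R (avgTrY i (parSymY i) U z w) (Λ w) a b‖ ^ 2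
          ≤ (∑ w, κb * avgCoeffY i z w) * ∑ w, κb * avgCoeffY i z w * ∑ a, ∑ b, ‖Λ w a b‖ ^ 2 :=
            mul_le_mul_of_nonneg_left (Finset.sum_le_sum fun w _ => mul_le_mul_of_nonneg_left (hR w) (mul_nonneg hκb (avgCoeffY_nonneg i z w)))
              (Finset.sum_nonneg fun w _ => mul_nonneg hκb (avgCoeffY_nonneg i z w))
        _ ≤ (κb * (((((ℓ + 1) ^ (blkOf i.D.toDomains z).1.1 : ℕ) : ℝ)) ^ 2)⁻¹) * ∑ w, κb * avgCoeffY i z w * ∑ a, ∑ b, ‖Λ w a b‖ ^ 2 :=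
            mul_le_mul_of_nonneg_right hsum hS0
        _ = _ := by rw [Finset.mul_sum, Finset.mul_sum]; exact Finset.sum_congr rfl fun w _ => by ring
    · -- `|avgCoeffY(z,w)·(h z − h w)| ≤ κ_b·avgCoeffY(z,w)` (zero off the block of `z`)
      show |avgCoeffY i z w * (h z - h w)| ≤ κb * avgCoeffY i z w
      by_cases hzw : blkOf i.D.toDomains w = blkOf i.D.toDomains z
      · rw [abs_mul, abs_of_nonneg (avgCoeffY_nonneg i z w), mul_comm]
        exact mul_le_mul_of_nonneg_right (hhb z w hzw) (avgCoeffY_nonneg i z w)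
      · rw [avgCoeffY_eq_ite, if_neg hzw, zero_mul, abs_zero, mul_zero]
  -- assemble: `HS(lineΔ + cst•Λ z + lineA) ≤ 4HS(lineΔ) + 4HS(cst•Λ z) + 2HS(lineA)`
  have hA := hs_add_le (lineΔ + cst • Λ z) lineA
  have hB := hs_add_le lineΔ (cst • Λ z)
  nlinarith [hs_nonneg lineΔ, hs_nonneg (cst • Λ z), hs_nonneg lineA]

/-! ## §K3 `∇*` read at the shifted site; the `K(h_□)`-factor of the walk in `L²` -/

/-- `HS((∇*_{U,μ}Φ)(z)) ≤ HS((∇_{U,μ}Φ)(z − e_μ))` (`∇*_μΦ(z) = −R(U_μ(z−e_μ))⁻¹(∇_μΦ)(z−e_μ)`; `G`-valued `U`, `G ≤ U(N)`).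
[cite: Balaban1985BackgroundPropagators, (3.8) p.392, (3.5) p.391] -/
theorem hs_cdsS_le_hs_cdS_symm (hG : G ≤ B7Prop2Explicit.unitaryUnits (Matrix (Fin N) (Fin N) ℂ)) {U : CfgY (Matrix (Fin N) (Fin N) ℂ) i}
    (hU : ∀ μ x, U μ x ∈ G) (μ : Fin (d + 1)) (Φ : SiteY i → Matrix (Fin N) (Fin N) ℂ) (z : SiteY i) :
    ∑ a, ∑ b, ‖cdsS i U μ Φ z a b‖ ^ 2 ≤ ∑ a, ∑ b, ‖cdS i U μ Φ ((shiftY i μ).symm z) a b‖ ^ 2 := by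
  have e : cdsS i U μ Φ z = -R (UboxY i U μ ((shiftY i μ).symm z))⁻¹ (cdS i U μ Φ ((shiftY i μ).symm z)) := by
    show R (UboxY i U μ ((shiftY i μ).symm z))⁻¹ (Φ ((shiftY i μ).symm z)) - Φ z
      = -R (UboxY i U μ ((shiftY i μ).symm z))⁻¹ (R (UboxY i U μ ((shiftY i μ).symm z)) (Φ (shiftY i μ ((shiftY i μ).symm z))) - Φ ((shiftY i μ).symm z))
    rw [R_sub, R_inv_R, Equiv.apply_symm_apply]
    abel
  rw [e]
  have hV := contractive_of_mem_unitary (V := UboxY i U μ ((shiftY i μ).symm z)) (hG (hU μ _))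
  have hVi : ‖(((UboxY i U μ ((shiftY i μ).symm z))⁻¹ : (Matrix (Fin N) (Fin N) ℂ)ˣ) : Matrix (Fin N) (Fin N) ℂ)‖ ≤ 1 ∧
      ‖((((UboxY i U μ ((shiftY i μ).symm z))⁻¹)⁻¹ : (Matrix (Fin N) (Fin N) ℂ)ˣ) : Matrix (Fin N) (Fin N) ℂ)‖ ≤ 1 := ⟨hV.2, by rw [inv_inv]; exact hV.1⟩
  have h := hs_R_le hVi (cdS i U μ Φ ((shiftY i μ).symm z))
  simp only [Matrix.neg_apply, norm_neg]
  exact h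

/-- ★★★ **THE `K(h_□)`-FACTOR OF THE WALK IN `L²`, UNIFORMLY IN □** — the 𝔸-level shape of dag-n06-k's `FactorsL2Mixed37.facDs` (`(P_□∇_U + C_□)G′_□(U)h_□∇*_{U,μ}` = print's
`K(h_□)G′_□h_□∇*_μ`, (3.88)–(3.89)): on the class, for ANY site set `D`, ANY real cut-off `h` with `|h| ≤ 1`, bond differences `≤ κ`, axis second differences `≤ κ₂`,
block oscillation `≤ κ_b`, a weight `ω` as in files 6∕8 with `ω = 1` on the source set `B ⊇ supp λ ∪ (supp λ + e_μ)` and `ω ≥ W` on `A` AND on its backward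
neighbours `A − e_ν`, `A` a union of blocks of `𝔅` (block-saturated) with levels in `[j′_A, j_A]`, levels `≤ j_B` on `B`:
`Σ_{z∈A} HS((K(h)(U) G′_□(U) M_h ∇*_{U,μ} λ)(z)) ≤ [16(d+1)(d+2)κ²(10 + 160κ²L^{2j_B}) + (8(d+1)²κ₂² + 4κ_b²L^{−4j′_A})(16 + 256κ²L^{2j_B})L^{2j_A}]∕W² · ‖λ‖²₁`
— with `κ, κ₂, κ_b = O((ML^{j})⁻¹), O((ML^j)⁻²), O(M⁻¹)` ([4] p. 247) and `j′_A ≈ j_A ≈ j` this is print's `θ_M²·(Lʲη)⁻²·e^{−2δ₀d}`, `θ_M = O(M⁻¹)`.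
[cite: Balaban1985BackgroundPropagators, (3.88)–(3.89) p.409, Cor 3.6 p.408, (3.46) p.398; Balaban1984PropagatorsII, (2.40)–(2.44) p.230, p.247; Agmon1982, Ch.1, Thm 1.5] -/
theorem hs_restrict_KhY_GsqY_cutMulY_cdsS_le [Nonempty (Fin N)] (hG : G ≤ B7Prop2Explicit.unitaryUnits (Matrix (Fin N) (Fin N) ℂ))
    {U : CfgY (Matrix (Fin N) (Fin N) ℂ) i} {c α₀ : ℝ} (hC0 : 0 ≤ c * (kGeo i).M * α₀) (hC1 : c * (kGeo i).M * α₀ * ((d : ℝ) + 1) ≤ 1 / 16)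
    (hreg : (bg9K (Matrix (Fin N) (Fin N) ℂ) G i).Reg335 c α₀ U) (D : Finset (SiteY i)) {ω : SiteY i → ℝ} (hω : ∀ z, 0 < ω z) {θb θs : ℝ}
    (hθb0 : 0 ≤ θb) (hθs0 : 0 ≤ θs)
    (hb1 : ∀ μ z, ω (shiftY i μ z) / ω z + ω z / ω (shiftY i μ z) - 2 ≤ θb * (((((ℓ + 1) ^ (blkOf i.D.toDomains z).1.1 : ℕ) : ℝ)) ^ 2)⁻¹)
    (hb2 : ∀ μ z, ω (shiftY i μ z) / ω z + ω z / ω (shiftY i μ z) - 2 ≤ θb * (((((ℓ + 1) ^ (blkOf i.D.toDomains (shiftY i μ z)).1.1 : ℕ) : ℝ)) ^ 2)⁻¹)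
    (hs : ∀ z w : SiteY i, blkOf i.D.toDomains w = blkOf i.D.toDomains z → ω z / ω w + ω w / ω z - 2 ≤ θs)
    (hκ : ((d : ℝ) + 1) * θb + θs / 2 ≤ 1 / 16)
    {h : SiteY i → ℝ} {κ κ₂ κb : ℝ} (hh1 : ∀ z, |h z| ≤ 1) (hhκ : ∀ μ z, |h (shiftY i μ z) - h z| ≤ κ)
    (hhκ₂ : ∀ μ z, |h (shiftY i μ z) + h ((shiftY i μ).symm z) - 2 * h z| ≤ κ₂)
    (hhb : ∀ z w : SiteY i, blkOf i.D.toDomains w = blkOf i.D.toDomains z → |h z - h w| ≤ κb) (μ : Fin (d + 1))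
    {A B : Finset (SiteY i)} (hAblk : ∀ z ∈ A, ∀ w, blkOf i.D.toDomains w = blkOf i.D.toDomains z → w ∈ A)
    {Λ : SiteY i → Matrix (Fin N) (Fin N) ℂ} (hΛ : ∀ z, z ∉ B → Λ z = 0)
    (hΛ' : ∀ z, z ∉ B → Λ ((shiftY i μ).symm z) = 0) (hωB : ∀ z ∈ B, ω z = 1)
    {jA jA' jB : ℕ} (hjA : ∀ z ∈ A, (blkOf i.D.toDomains z).1.1 ≤ jA) (hjA' : ∀ z ∈ A, jA' ≤ (blkOf i.D.toDomains z).1.1)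
    (hjB : ∀ z ∈ B, (blkOf i.D.toDomains z).1.1 ≤ jB)
    {W : ℝ} (hW0 : 0 < W) (hW : ∀ z ∈ A, W ≤ ω z) (hW' : ∀ ν, ∀ z ∈ A, W ≤ ω ((shiftY i ν).symm z)) :
    ∑ z ∈ A, ∑ a, ∑ b, ‖KhY i (parSymY i) h U (GsqY i (parSymY i) D U (cutMulY h (cdsS i U μ Λ))) z a b‖ ^ 2
      ≤ (16 * ((d : ℝ) + 1) * ((d : ℝ) + 2) * κ ^ 2 * (10 + 160 * κ ^ 2 * ((((ℓ + 1) ^ jB : ℕ) : ℝ)) ^ 2)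
          + (8 * (((d : ℝ) + 1) * κ₂) ^ 2 + 4 * κb ^ 2 * ((((((ℓ + 1) ^ jA' : ℕ) : ℝ)) ^ 2)⁻¹) ^ 2)
            * ((16 + 256 * κ ^ 2 * ((((ℓ + 1) ^ jB : ℕ) : ℝ)) ^ 2) * ((((ℓ + 1) ^ jA : ℕ) : ℝ)) ^ 2))
        / W ^ 2 * trIP (fun _ => (1 : ℝ)) Λ Λ := by
  classical
  have hU : ∀ μ x, U μ x ∈ G := hreg.1
  set Φ := GsqY i (parSymY i) D U (cutMulY h (cdsS i U μ Λ)) with hΦ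
  set Q := trIP (fun _ => (1 : ℝ)) Λ Λ with hQ
  have hQ0 : 0 ≤ Q := trIP_self_nonneg _ (fun _ => one_pos) Λ
  have hW2 : (0 : ℝ) < W ^ 2 := by positivity
  set LB := ((((ℓ + 1) ^ jB : ℕ) : ℝ)) ^ 2 with hLB
  set LA := ((((ℓ + 1) ^ jA : ℕ) : ℝ)) ^ 2 with hLA
  set mA := (((((ℓ + 1) ^ jA' : ℕ) : ℝ)) ^ 2)⁻¹ with hmA
  -- the two □-uniform inputs of file-22 type: `Φ` and `∇Φ` on `A` (and on the backward neighbours of `A`)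
  have mΦ : ∑ z ∈ A, ∑ a, ∑ b, ‖Φ z a b‖ ^ 2 ≤ 2 * ((16 + 256 * κ ^ 2 * LB) * LA) / W ^ 2 * Q :=
    hs_restrict_GsqY_cutMulY_cdsS_le i hG hC0 hC1 hreg D hω hb1 hb2 hs hκ hh1 hhκ μ hΛ hΛ' hωB hjA hjB hW0 hW
  have mD : ∑ z ∈ A, ∑ ν : Fin (d + 1), ∑ a, ∑ b, ‖cdS i U ν Φ z a b‖ ^ 2 ≤ 2 * (10 + 160 * κ ^ 2 * LB) / W ^ 2 * Q :=
    hs_restrict_cdS_GsqY_cutMulY_cdsS_le i hG hC0 hC1 hreg D hω hθb0 hθs0 hb1 hb2 hs hκ hh1 hhκ μ hΛ hΛ' hωB hjB hW0 hW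
  have mD' : ∀ ν : Fin (d + 1), ∑ z ∈ A, ∑ a, ∑ b, ‖cdsS i U ν Φ z a b‖ ^ 2 ≤ 2 * (10 + 160 * κ ^ 2 * LB) / W ^ 2 * Q := by
    intro ν
    -- `Σ_{z∈A} HS(∇*_νΦ z) ≤ Σ_{z∈A−e_ν}HS(∇_νΦ z) ≤ Σ_{z∈A−e_ν}Σ_ν' HS(∇_ν'Φ z)`
    have h1 : ∑ z ∈ A, ∑ a, ∑ b, ‖cdsS i U ν Φ z a b‖ ^ 2 ≤ ∑ z ∈ A.image (shiftY i ν).symm, ∑ a, ∑ b, ‖cdS i U ν Φ z a b‖ ^ 2 := by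
      rw [Finset.sum_image (fun x _ y _ hxy => (shiftY i ν).symm.injective hxy)]
      exact Finset.sum_le_sum fun z _ => hs_cdsS_le_hs_cdS_symm i hG hU ν Φ z
    have hW'' : ∀ z ∈ A.image (shiftY i ν).symm, W ≤ ω z := by
      intro z hz
      obtain ⟨x, hx, rfl⟩ := Finset.mem_image.1 hz
      exact hW' ν x hx
    have h2 := hs_restrict_cdS_GsqY_cutMulY_cdsS_le i hG hC0 hC1 hreg D hω hθb0 hθs0 hb1 hb2 hs hκ hh1 hhκ μ hΛ hΛ' hωB hjB hW0 hW''
    refine h1.trans (le_trans (Finset.sum_le_sum fun z _ => ?_) h2)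
    exact Finset.single_le_sum (f := fun ν' : Fin (d + 1) => ∑ a, ∑ b, ‖cdS i U ν' Φ z a b‖ ^ 2) (fun _ _ => hs_nonneg _) (Finset.mem_univ ν)
  -- the averaging line summed over the block-saturated `A`
  have mAvg : ∑ z ∈ A, ((((((ℓ + 1) ^ (blkOf i.D.toDomains z).1.1 : ℕ) : ℝ)) ^ 2)⁻¹ * ∑ w, avgCoeffY i z w * ∑ a, ∑ b, ‖Φ w a b‖ ^ 2)
      ≤ mA ^ 2 * ∑ w ∈ A, ∑ a, ∑ b, ‖Φ w a b‖ ^ 2 := by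
    -- pointwise: `m_z ≤ mA`; the `w`-sum only meets the block of `z ⊆ A`
    have hmz : ∀ z ∈ A, (((((ℓ + 1) ^ (blkOf i.D.toDomains z).1.1 : ℕ) : ℝ)) ^ 2)⁻¹ ≤ mA := by
      intro z hz
      apply inv_anti₀ (by positivity)
      have : (((ℓ + 1) ^ jA' : ℕ) : ℝ) ≤ (((ℓ + 1) ^ (blkOf i.D.toDomains z).1.1 : ℕ) : ℝ) := by
        exact_mod_cast Nat.pow_le_pow_right (Nat.succ_pos ℓ) (hjA' z hz)
      exact pow_le_pow_left₀ (by positivity) this 2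
    have hin : ∀ z ∈ A, ∑ w, avgCoeffY i z w * ∑ a, ∑ b, ‖Φ w a b‖ ^ 2 = ∑ w ∈ A, avgCoeffY i z w * ∑ a, ∑ b, ‖Φ w a b‖ ^ 2 := by
      intro z hz
      rw [← Finset.sum_subset (Finset.subset_univ A)]
      intro w _ hw
      have : blkOf i.D.toDomains w ≠ blkOf i.D.toDomains z := fun hzw => hw (hAblk z hz w hzw)
      rw [avgCoeffY_eq_ite, if_neg this, zero_mul]
    calc ∑ z ∈ A, ((((((ℓ + 1) ^ (blkOf i.D.toDomains z).1.1 : ℕ) : ℝ)) ^ 2)⁻¹ * ∑ w, avgCoeffY i z w * ∑ a, ∑ b, ‖Φ w a b‖ ^ 2)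
        ≤ ∑ z ∈ A, (mA * ∑ w ∈ A, avgCoeffY i z w * ∑ a, ∑ b, ‖Φ w a b‖ ^ 2) := by
          refine Finset.sum_le_sum fun z hz => ?_
          rw [hin z hz]
          exact mul_le_mul_of_nonneg_right (hmz z hz) (Finset.sum_nonneg fun w _ => mul_nonneg (avgCoeffY_nonneg i z w) (hs_nonneg _))
      _ = mA * ∑ w ∈ A, (∑ z ∈ A, avgCoeffY i z w) * ∑ a, ∑ b, ‖Φ w a b‖ ^ 2 := by
          rw [← Finset.mul_sum, Finset.sum_comm]
          congr 1
          exact Finset.sum_congr rfl fun w _ => by rw [Finset.sum_mul]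
      _ ≤ mA * ∑ w ∈ A, (mA * ∑ a, ∑ b, ‖Φ w a b‖ ^ 2) := by
          refine mul_le_mul_of_nonneg_left (Finset.sum_le_sum fun w hw => mul_le_mul_of_nonneg_right ?_ (hs_nonneg _)) (by positivity)
          calc ∑ z ∈ A, avgCoeffY i z w ≤ ∑ z, avgCoeffY i z w :=
                Finset.sum_le_univ_sum_of_nonneg fun z => avgCoeffY_nonneg i z w
            _ = ∑ z, avgCoeffY i w z := Finset.sum_congr rfl fun z _ => avgCoeffY_symm i z w
            _ ≤ _ := (sum_avgCoeffY_le i w).trans (hmz w hw)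
      _ = mA ^ 2 * ∑ w ∈ A, ∑ a, ∑ b, ‖Φ w a b‖ ^ 2 := by rw [← Finset.mul_sum]; ring
  -- sum the pointwise bound over `A`
  have hpt := fun z => hs_KhY_apply_le i hG hU hhκ hhκ₂ hhb Φ z
  refine (Finset.sum_le_sum fun z (_ : z ∈ A) => hpt z).trans ?_
  rw [Finset.sum_add_distrib, Finset.sum_add_distrib, ← Finset.mul_sum, ← Finset.mul_sum]
  -- the three groups
  have hκ0 : 0 ≤ κ := le_trans (abs_nonneg _) (hhκ μ (Classical.arbitrary _))
  have hκb0 : 0 ≤ κb := le_trans (abs_nonneg _) (hhb (Classical.arbitrary _) (Classical.arbitrary _) rfl)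
  have g1 : ∑ z ∈ A, ∑ ν : Fin (d + 1), (∑ a, ∑ b, ‖cdS i U ν Φ z a b‖ ^ 2 + ∑ a, ∑ b, ‖cdsS i U ν Φ z a b‖ ^ 2)
      ≤ ((d : ℝ) + 2) * (2 * (10 + 160 * κ ^ 2 * LB) / W ^ 2 * Q) := by
    rw [Finset.sum_comm]
    simp only [Finset.sum_add_distrib]
    have hA1 : ∑ ν : Fin (d + 1), ∑ z ∈ A, ∑ a, ∑ b, ‖cdS i U ν Φ z a b‖ ^ 2 ≤ 2 * (10 + 160 * κ ^ 2 * LB) / W ^ 2 * Q := by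
      rw [Finset.sum_comm]; exact mD
    have hA2 : ∑ ν : Fin (d + 1), ∑ z ∈ A, ∑ a, ∑ b, ‖cdsS i U ν Φ z a b‖ ^ 2 ≤ ((d : ℝ) + 1) * (2 * (10 + 160 * κ ^ 2 * LB) / W ^ 2 * Q) := by
      calc ∑ ν : Fin (d + 1), ∑ z ∈ A, ∑ a, ∑ b, ‖cdsS i U ν Φ z a b‖ ^ 2 ≤ ∑ _ν : Fin (d + 1), 2 * (10 + 160 * κ ^ 2 * LB) / W ^ 2 * Q :=
            Finset.sum_le_sum fun ν _ => mD' ν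
        _ = _ := by rw [Finset.sum_const, Finset.card_univ, Fintype.card_fin, nsmul_eq_mul]; push_cast; ring
    linarith
  have g3 := mAvg.trans (mul_le_mul_of_nonneg_left mΦ (sq_nonneg _))
  have g3' : ∑ z ∈ A, 2 * κb ^ 2 * (((((ℓ + 1) ^ (blkOf i.D.toDomains z).1.1 : ℕ) : ℝ)) ^ 2)⁻¹ * ∑ w, avgCoeffY i z w * ∑ a, ∑ b, ‖Φ w a b‖ ^ 2
      ≤ 2 * κb ^ 2 * (mA ^ 2 * (2 * ((16 + 256 * κ ^ 2 * LB) * LA) / W ^ 2 * Q)) := by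
    have e : ∑ z ∈ A, 2 * κb ^ 2 * (((((ℓ + 1) ^ (blkOf i.D.toDomains z).1.1 : ℕ) : ℝ)) ^ 2)⁻¹ * ∑ w, avgCoeffY i z w * ∑ a, ∑ b, ‖Φ w a b‖ ^ 2
        = 2 * κb ^ 2 * ∑ z ∈ A, ((((((ℓ + 1) ^ (blkOf i.D.toDomains z).1.1 : ℕ) : ℝ)) ^ 2)⁻¹ * ∑ w, avgCoeffY i z w * ∑ a, ∑ b, ‖Φ w a b‖ ^ 2) := by
      rw [Finset.mul_sum]
      exact Finset.sum_congr rfl fun z _ => by ring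
    rw [e]
    exact mul_le_mul_of_nonneg_left g3 (by positivity)
  have etot : (16 * ((d : ℝ) + 1) * ((d : ℝ) + 2) * κ ^ 2 * (10 + 160 * κ ^ 2 * LB)
          + (8 * (((d : ℝ) + 1) * κ₂) ^ 2 + 4 * κb ^ 2 * mA ^ 2) * ((16 + 256 * κ ^ 2 * LB) * LA)) / W ^ 2 * Q
      = 8 * ((d : ℝ) + 1) * κ ^ 2 * (((d : ℝ) + 2) * (2 * (10 + 160 * κ ^ 2 * LB) / W ^ 2 * Q))
        + 4 * (((d : ℝ) + 1) * κ₂) ^ 2 * (2 * ((16 + 256 * κ ^ 2 * LB) * LA) / W ^ 2 * Q)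
        + 2 * κb ^ 2 * (mA ^ 2 * (2 * ((16 + 256 * κ ^ 2 * LB) * LA) / W ^ 2 * Q)) := by
    field_simp
    ring
  rw [etot]
  exact add_le_add (add_le_add (mul_le_mul_of_nonneg_left g1 (by positivity)) (mul_le_mul_of_nonneg_left mΦ (by positivity))) g3'


end Factors

end Literature.MathematicalPhysics.QuantumFieldTheory.Balaban1983to89.B9Thm31SiteGsqCutoffFactorsReg335Y
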